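import Summits.Ventures.LatticeQCDFlow.TrivializingMaps.WilsonGradientBound
import Summits.Ventures.LatticeQCDFlow.TrivializingMaps.WilsonNonInteractingLinks
import Summits.Ventures.LatticeQCDFlow.TrivializingMaps.WilsonMeasureTrivializingMap
import Summits.Ventures.LatticeQCDFlow.TrivializingMaps.StaircaseMeanActionLaw
import Summits.Ventures.LatticeQCDFlow.TrivializingMaps.SuBasisExistence
import Summits.Ventures.LatticeQCDFlow.TrivializingMaps.HaarByPartsZeroModes
import Literature.MathematicalPhysics.QuantumFieldTheory.Luscher2010.FlowActionSeriesProofs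
import Literature.MathematicalPhysics.QuantumLattice.RepLieAlgebraUnitary
import Summits.Ventures.LatticeQCDFlow.Scaling.ExtensiveSpecificHeat
import Summits.Ventures.LatticeQCDFlow.Scaling.SchwingerDysonVarianceFloor
import HarnessLib

/-!
HONEST FRAMING: exact (Metropolis-corrected) sampling algorithms for lattice gauge theory; figures
of merit are autocorrelation/cost numbers at stated couplings and volumes; no continuum-physics
claim.

# WilsonSpecificHeatFloorCasimir — THE GLOBAL CASIMIR IDENTITY `Σₑ ΔₑS_W = 4C_F·(c − S_W)` AND THE
# VOLUME-UNIFORM MEAN-ACTION DEFICIT (theory2 item 128, PART 3 of 4: §C–§D)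

CUSTODY: theory2 item 128 (GEN-41, HOME tier) re-landed by lean-2 GEN-10 per LEAD LINE 255 RL-47 (116);
statements and proofs = HOME/lean/theory2/WilsonSpecificHeatFloor.lean 07cab9e5ed9822d9 (1 031 l)
verbatim, split below the `lint.size` line into FOUR files (`WilsonSpecificHeatFloorShift` §A,
`WilsonSpecificHeatFloorDeriv` §B1–§B4, `WilsonSpecificHeatFloorCasimir` §C–§D,
`WilsonSpecificHeatFloor` §E–§F; parts 1–3 are mutually independent, part 4 imports them); headers
trimmed; imports = HOME's (its three `Scaling.*` placeholder lines ARE the tree module names of items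
125 / 126 / 127 as landed by lean-2 GEN-9) minus item 125, which only PART 4 §F needs; landing edits:
docstrings added where the lint asks (builder `build128.py` in the custodian's seat folder).

THEORY-2 item 128 (theory2 GEN-41; cell pub-lqcd / Ventures/LatticeQCDFlow).  Main theorem of the
series (`wilsonSpecificHeatFloorUniform`, PART 4): pure `SU(n)` Wilson theory on the torus `(ℤ/L)^d`;
for `n ≥ 2`, `d ≥ 2`, `β₀ > 0` there is `c = c(d, n, β₀) > 0` with
`Var_{π_u}(S_W) ≥ c · #plaquettes(d, L) / u²` for every `L ≥ 2` and every `u ≥ β₀` — item 125's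
conjecture (SH_W), uniform in the volume, hence item 125's `log² R` layer laws unconditional.

This part (§C = step (CAS), §D = step (MP)): §C the quadratic Casimir `C_F = (n² − 1)/(2n)`
(`casimirF`), each `Re tr U_p` is an eigenfunction of Lüscher's link Laplacian (`linkLap_plaqRe`, from
the Literature `linkLap_re_trace_plaquette`, Lüscher 2010 eq. (3.10)), and the pointwise identity
`Σₑ ΔₑS_W(W) = 4C_F·(c − S_W(W))` with `c = plaqConst d L n` (`sum_dirLap_ambWilsonAction`); §D the
MEAN-ACTION DEFICIT, uniform in the volume: on `(ℤ/L)^{d+2}`, `L ≥ 2`, `0 ≤ β₀ ≤ β`,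
`E_0[S_W] − E_β[S_W] = ∫_0^β Var_t(S_W) dt ≥ β₀ · L⌊L/2⌋^{d+1} e^{−8n(d+1)β₀} · Var_Haar(Re tr g)`
(`meanAction_deficit`: the fluctuation relation `meanAction_sub_eq_integral_variance` of the tree's
`StaircaseMeanActionLaw` + item 126's window floor `wilson_variance_ge_extensive_window`); the Casimir
constant is the infinite-temperature mean action, `c = E_0[S_W]` (`plaqConst_eq`, integration by parts
at `β = 0` via item 127's `integral_dirLap_mul_weight`); hence the total mean Laplacian floor
`Σₑ E_β[ΔₑS_W] ≥ 4C_F · β₀ · L⌊L/2⌋^{d+1} e^{−8n(d+1)β₀} V_H(n)` (`sum_integral_dirLap_ge`).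
-/

noncomputable section

set_option linter.unusedSectionVars false

namespace Summit.Ventures.LatticeQCDFlow.Theory2.WilsonSpecificHeat

open MeasureTheory ProbabilityTheory
open Literature.MathematicalPhysics.QuantumFieldTheory
open Literature.MathematicalPhysics.QuantumFieldTheory.Luscher2010
open Literature.MathematicalPhysics.QuantumFieldTheory.WilsonFlow (coeConfig continuous_coeConfig
  coeConfig_apply)
open Summit.Ventures.LatticeQCDFlow.TrivializingMaps
open Summit.Ventures.LatticeQCDFlow.Theory2.SchwingerDyson (dirLap)
open scoped Matrix Matrix.Norms.Frobenius ContDiff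

variable {d L n : ℕ}

/-! ## §C. The global Casimir identity `Σₑ ΔₑS_W = 4C_F·(c − S_W)` -/

section Casimir

variable [NeZero L]

/-- The quadratic Casimir `C_F = (n² − 1)/(2n)` of the fundamental representation. [folklore] -/
def casimirF (n : ℕ) : ℝ := ((n : ℝ) ^ 2 - 1) / (2 * n)

/-- `C_F > 0` for `n ≥ 2`. [folklore] -/
theorem casimirF_pos (hn : 2 ≤ n) : 0 < casimirF n := by
  unfold casimirF
  have h : (2 : ℝ) ≤ n := by exact_mod_cast hn
  apply div_pos <;> nlinarith

/-- `Σₑ ΔₑF = −ΔF` (`Δ` = Lüscher's `linkLap`, `Δₑ` = item 127's `dirLap` along the basis).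
[folklore] -/
theorem sum_dirLap_eq_neg_linkLap (B : SuBasis n) (f : AmbConfig d L n → ℝ) (W : AmbConfig d L n) :
    ∑ e, dirLap B.T f e W = -linkLap B f W := by
  simp only [dirLap, linkLap, neg_neg]

/-- `Δ` kills constants. [folklore] -/
theorem linkLap_const (B : SuBasis n) (c : ℝ) (W : AmbConfig d L n) :
    linkLap B (fun _ : AmbConfig d L n => c) W = 0 := by
  simp [linkLap, linkDeriv_const]

/-- **The plaquette is a `Δ`-eigenfunction**: `Δ plaqRe = 4C_F·(plaqRe − n)` for `μ ≠ ν`, `L ≥ 2`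
(`plaqRe = n − Re tr U_p` and the tree's `linkLap_re_trace_plaquette`).
[cite: Luscher2010Trivializing, §3.3 eq. (3.10)] -/
theorem linkLap_plaqRe (hL : 2 ≤ L) (B : SuBasis n) (x : Site d L) {μ ν : Fin d} (hμν : μ ≠ ν)
    (W : AmbConfig d L n) :
    linkLap B (plaqRe x μ ν) W = 4 * casimirF n * (plaqRe x μ ν W - n) := by
  have hpl : (plaqRe (n := n) x μ ν) = fun V => (n : ℝ) -
      (V (x, μ) * V (x.shift μ, ν) * (V (x.shift ν, μ))ᴴ * (V (x, ν))ᴴ).trace.re := by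
    funext V
    simp only [plaqRe, Matrix.trace_sub, Matrix.trace_one, Complex.sub_re, Fintype.card_fin,
      Complex.natCast_re]
  have hgs : ContDiff ℝ ∞ fun V : AmbConfig d L n =>
      (V (x, μ) * V (x.shift μ, ν) * (V (x.shift ν, μ))ᴴ * (V (x, ν))ᴴ).trace.re := by
    have h2 : (fun V : AmbConfig d L n =>
        (V (x, μ) * V (x.shift μ, ν) * (V (x.shift ν, μ))ᴴ * (V (x, ν))ᴴ).trace.re) =
        fun V => (n : ℝ) - plaqRe x μ ν V := by
      funext V
      simp only [hpl]
      ring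
    rw [h2]
    exact contDiff_const.sub (contDiff_of_mem_PD (plaqRe_mem x μ ν))
  rw [hpl, linkLap_sub_of_contDiff B contDiff_const hgs W, linkLap_const,
    linkLap_re_trace_plaquette hL B W x hμν]
  simp only [casimirF]
  ring

/-- The constant `c(d, L, n) = n · #{(x, μ, ν) : μ < ν}` (the value of `Σ_p [μ<ν]·n`). -/
def plaqConst (d L n : ℕ) [NeZero L] : ℝ :=
  ∑ p : Site d L × Fin d × Fin d, if p.2.1 < p.2.2 then (n : ℝ) else 0

/-- **Global Casimir identity** (pointwise, every ambient configuration, `L ≥ 2`):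
`Σₑ ΔₑS_W(W) = 4C_F·(c − S_W(W))`. [folklore; Lüscher 2010 eq. (3.10) summed over plaquettes] -/
theorem sum_dirLap_ambWilsonAction (hL : 2 ≤ L) (B : SuBasis n) (W : AmbConfig d L n) :
    ∑ e, dirLap B.T (ambWilsonAction : AmbConfig d L n → ℝ) e W =
      4 * casimirF n * (plaqConst d L n - ambWilsonAction W) := by
  rw [sum_dirLap_eq_neg_linkLap, ambWilsonAction_eq_sum_plaqTerm,
    linkLap_finset_sum B Finset.univ (fun p : Site d L × Fin d × Fin d => plaqTerm p)
      (fun p _ => contDiff_plaqTerm p)]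
  have hterm : ∀ p : Site d L × Fin d × Fin d, linkLap B (plaqTerm p) W =
      4 * casimirF n * (plaqTerm p W - if p.2.1 < p.2.2 then (n : ℝ) else 0) := by
    intro p
    by_cases h : p.2.1 < p.2.2
    · rw [plaqTerm_of_lt h, linkLap_plaqRe hL B p.1 (ne_of_lt h) W, if_pos h]
    · rw [plaqTerm_of_not_lt h, linkLap_const, if_neg h]
      ring
  simp only [hterm, plaqConst]
  rw [← Finset.mul_sum, Finset.sum_sub_distrib]
  ring

end Casimir

/-! ## §D. The mean-action deficit and the total mean Laplacian -/

section MeanPlaquette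

variable [NeZero L]

/-- The ambient spelling of `Var_t(S_W)` is item 126's representation spelling (defining
representation of `SU(n)`). [ours; tree `StrongCoupling.boltzmannMeasure_smul_ambWilsonAction`] -/
theorem variance_amb_eq (t : ℝ) :
    variance (fun U => ambWilsonAction (coeConfig U))
        (boltzmannMeasure fun U : GaugeConfig d L (Matrix.specialUnitaryGroup (Fin n) ℂ) =>
          t * ambWilsonAction (coeConfig U)) =
      variance (wilsonAction (d := d) (L := L) (StrongCoupling.defRep n))
        (wilsonMeasure (d := d) (L := L) (StrongCoupling.defRep n) t) := by
  rw [StrongCoupling.boltzmannMeasure_smul_ambWilsonAction t]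
  congr 1
  funext U
  exact StrongCoupling.ambWilsonAction_coeConfig U

/-- The single-link Haar variance `V_H(n) = Var_Haar(Re tr g) = ∫ (Re tr g)² dg > 0` for `n ≥ 2`.
[folklore; tree `haarSqReTrace_pos`, `integral_re_trace_haar_eq_zero`] -/
theorem haarVar_pos (hn : 2 ≤ n) :
    0 < variance (fun g : ↥(Matrix.specialUnitaryGroup (Fin n) ℂ) =>
        ((StrongCoupling.defRep n) g).trace.re)
      (haarProbability ↥(Matrix.specialUnitaryGroup (Fin n) ℂ)) := by
  have hφ : Continuous fun g : ↥(Matrix.specialUnitaryGroup (Fin n) ℂ) =>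
      ((g : Matrix (Fin n) (Fin n) ℂ)).trace.re :=
    Complex.continuous_re.comp continuous_subtype_val.matrix_trace
  have hdef : (fun g : ↥(Matrix.specialUnitaryGroup (Fin n) ℂ) =>
      ((StrongCoupling.defRep n) g).trace.re) =
      fun g : ↥(Matrix.specialUnitaryGroup (Fin n) ℂ) =>
        ((g : Matrix (Fin n) (Fin n) ℂ)).trace.re := rfl
  rw [hdef, variance_eq_integral hφ.aemeasurable]
  simp only [integral_re_trace_haar_eq_zero hn, sub_zero]
  exact haarSqReTrace_pos (by omega)

/-- **Mean-action deficit, uniform in the volume.** On the torus `(ℤ/L)^{d+2}`, `L ≥ 2`, for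
`0 ≤ β₀ ≤ β`:
`E_0[S_W] − E_β[S_W] = ∫_0^β Var_t(S_W) dt ≥ β₀ · L⌊L/2⌋^{d+1} e^{−8n(d+1)β₀} · V_H(n)`
(fluctuation relation `StaircaseMeanActionLaw` + item 126's window floor). [ours] -/
theorem meanAction_deficit (hL : 2 ≤ L) {β₀ β : ℝ} (hβ₀ : 0 ≤ β₀) (hβ : β₀ ≤ β) :
    β₀ * ((((L * (L / 2) ^ (d + 1) : ℕ) : ℝ) * Real.exp (-(8 * n * (d + 1) * β₀))) *
        variance (fun g : ↥(Matrix.specialUnitaryGroup (Fin n) ℂ) =>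
          ((StrongCoupling.defRep n) g).trace.re)
          (haarProbability ↥(Matrix.specialUnitaryGroup (Fin n) ℂ))) ≤
      (∫ U, ambWilsonAction (coeConfig U)
          ∂(boltzmannMeasure fun U : GaugeConfig (d + 2) L (Matrix.specialUnitaryGroup (Fin n) ℂ) =>
            (0 : ℝ) * ambWilsonAction (coeConfig U))) -
        ∫ U, ambWilsonAction (coeConfig U)
          ∂(boltzmannMeasure fun U : GaugeConfig (d + 2) L (Matrix.specialUnitaryGroup (Fin n) ℂ) =>
            β * ambWilsonAction (coeConfig U)) := by
  haveI : SecondCountableTopology (Matrix (Fin n) (Fin n) ℂ) :=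
    inferInstanceAs (SecondCountableTopology (Fin n → Fin n → ℂ))
  haveI : SecondCountableTopology ↥(Matrix.specialUnitaryGroup (Fin n) ℂ) :=
    Topology.IsEmbedding.subtypeVal.secondCountableTopology
  have hS : ContDiff ℝ ∞ (ambWilsonAction : AmbConfig (d + 2) L n → ℝ) := contDiff_ambWilsonAction
  rw [meanAction_sub_eq_integral_variance hS 0 β]
  set m : ℝ := (((L * (L / 2) ^ (d + 1) : ℕ) : ℝ) * Real.exp (-(8 * n * (d + 1) * β₀))) *
    variance (fun g : ↥(Matrix.specialUnitaryGroup (Fin n) ℂ) =>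
      ((StrongCoupling.defRep n) g).trace.re)
      (haarProbability ↥(Matrix.specialUnitaryGroup (Fin n) ℂ)) with hm
  have hcont := continuous_variance_boltzmann (d := d + 2) (L := L) (n := n) hS
  have hfloor : ∀ t ∈ Set.Icc 0 β₀, m ≤ variance (fun U => ambWilsonAction (coeConfig U))
      (boltzmannMeasure fun U : GaugeConfig (d + 2) L (Matrix.specialUnitaryGroup (Fin n) ℂ) =>
        t * ambWilsonAction (coeConfig U)) := by
    intro t ht
    rw [variance_amb_eq t]
    have habs : |t| ≤ β₀ := by rw [abs_of_nonneg ht.1]; exact ht.2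
    exact Theory2.ExtensiveSpecificHeat.wilson_variance_ge_extensive_window
      (StrongCoupling.defRep n) hL continuous_subtype_val habs
  have hβ₀β : 0 ≤ ∫ t in β₀..β, variance (fun U => ambWilsonAction (coeConfig U))
      (boltzmannMeasure fun U : GaugeConfig (d + 2) L (Matrix.specialUnitaryGroup (Fin n) ℂ) =>
        t * ambWilsonAction (coeConfig U)) :=
    intervalIntegral.integral_nonneg hβ fun t _ => variance_nonneg _ _
  calc β₀ * m = ∫ _ in (0 : ℝ)..β₀, m := by
        rw [intervalIntegral.integral_const, smul_eq_mul, sub_zero]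
    _ ≤ ∫ t in (0 : ℝ)..β₀, variance (fun U => ambWilsonAction (coeConfig U))
          (boltzmannMeasure fun U : GaugeConfig (d + 2) L (Matrix.specialUnitaryGroup (Fin n) ℂ) =>
            t * ambWilsonAction (coeConfig U)) :=
        intervalIntegral.integral_mono_on hβ₀ intervalIntegrable_const
          (hcont.intervalIntegrable _ _) hfloor
    _ ≤ (∫ t in (0 : ℝ)..β₀, variance (fun U => ambWilsonAction (coeConfig U))
          (boltzmannMeasure fun U : GaugeConfig (d + 2) L (Matrix.specialUnitaryGroup (Fin n) ℂ) =>
            t * ambWilsonAction (coeConfig U))) +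
        ∫ t in β₀..β, variance (fun U => ambWilsonAction (coeConfig U))
          (boltzmannMeasure fun U : GaugeConfig (d + 2) L (Matrix.specialUnitaryGroup (Fin n) ℂ) =>
            t * ambWilsonAction (coeConfig U)) := le_add_of_nonneg_right hβ₀β
    _ = ∫ t in (0 : ℝ)..β, variance (fun U => ambWilsonAction (coeConfig U))
          (boltzmannMeasure fun U : GaugeConfig (d + 2) L (Matrix.specialUnitaryGroup (Fin n) ℂ) =>
            t * ambWilsonAction (coeConfig U)) :=
        intervalIntegral.integral_add_adjacent_intervals (hcont.intervalIntegrable _ _)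
          (hcont.intervalIntegrable _ _)

/-- **Expectation of the global Casimir identity**:
`Σₑ E_β[ΔₑS_W] = 4C_F·(c − E_β[S_W])` at every coupling. [ours] -/
theorem sum_integral_dirLap_eq (hL : 2 ≤ L) (B : SuBasis n) (β : ℝ) :
    ∑ e, ∫ U, dirLap B.T (ambWilsonAction : AmbConfig d L n → ℝ) e (coeConfig U)
        ∂(boltzmannMeasure fun U : GaugeConfig d L (Matrix.specialUnitaryGroup (Fin n) ℂ) =>
          β * ambWilsonAction (coeConfig U)) =
      4 * casimirF n * (plaqConst d L n - ∫ U, ambWilsonAction (coeConfig U)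
        ∂(boltzmannMeasure fun U : GaugeConfig d L (Matrix.specialUnitaryGroup (Fin n) ℂ) =>
          β * ambWilsonAction (coeConfig U))) := by
  have hS : ContDiff ℝ ∞ (ambWilsonAction : AmbConfig d L n → ℝ) := contDiff_ambWilsonAction
  haveI : IsProbabilityMeasure (boltzmannMeasure fun U :
      GaugeConfig d L (Matrix.specialUnitaryGroup (Fin n) ℂ) =>
        β * ambWilsonAction (coeConfig U)) :=
    Theory2.SchwingerDyson.isProbabilityMeasure_gibbs hS β
  have hint : ∀ e, Integrable (fun U : GaugeConfig d L (Matrix.specialUnitaryGroup (Fin n) ℂ) =>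
      dirLap B.T (ambWilsonAction : AmbConfig d L n → ℝ) e (coeConfig U))
      (boltzmannMeasure fun U : GaugeConfig d L (Matrix.specialUnitaryGroup (Fin n) ℂ) =>
        β * ambWilsonAction (coeConfig U)) := fun e =>
    Theory2.SchwingerDyson.integrable_of_continuous
      (continuous_comp_coeConfig (Theory2.SchwingerDyson.contDiff_dirLap hS B.T e))
  have hintS : Integrable (fun U : GaugeConfig d L (Matrix.specialUnitaryGroup (Fin n) ℂ) =>
      ambWilsonAction (coeConfig U))
      (boltzmannMeasure fun U : GaugeConfig d L (Matrix.specialUnitaryGroup (Fin n) ℂ) =>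
        β * ambWilsonAction (coeConfig U)) :=
    Theory2.SchwingerDyson.integrable_of_continuous (continuous_comp_coeConfig hS)
  rw [← integral_finsetSum Finset.univ (fun e _ => hint e)]
  have hpt : ∀ U : GaugeConfig d L (Matrix.specialUnitaryGroup (Fin n) ℂ),
      ∑ e, dirLap B.T (ambWilsonAction : AmbConfig d L n → ℝ) e (coeConfig U) =
        4 * casimirF n * (plaqConst d L n - ambWilsonAction (coeConfig U)) := fun U =>
    sum_dirLap_ambWilsonAction hL B (coeConfig U)
  simp_rw [hpt]
  rw [integral_const_mul, integral_sub (integrable_const _) hintS, integral_const]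
  simp

/-- At `β = 0` every mean Laplacian vanishes (integration by parts against the flat weight:
item 127's `integral_dirLap_mul_weight` at `β = 0`). [ours] -/
theorem integral_dirLap_zero (B : SuBasis n) (e : Edge d L) :
    ∫ U, dirLap B.T (ambWilsonAction : AmbConfig d L n → ℝ) e (coeConfig U)
        ∂(boltzmannMeasure fun U : GaugeConfig d L (Matrix.specialUnitaryGroup (Fin n) ℂ) =>
          (0 : ℝ) * ambWilsonAction (coeConfig U)) = 0 := by
  have hS : ContDiff ℝ ∞ (ambWilsonAction : AmbConfig d L n → ℝ) := contDiff_ambWilsonAction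
  have hμ : (boltzmannMeasure fun U : GaugeConfig d L (Matrix.specialUnitaryGroup (Fin n) ℂ) =>
      (0 : ℝ) * ambWilsonAction (coeConfig U)) =
      trivialMeasure (Matrix.specialUnitaryGroup (Fin n) ℂ) d L := by
    rw [boltzmannMeasure_smul_eq_tilted hS 0]
    haveI := Theory2.SchwingerDyson.isProbabilityMeasure_trivialMeasure (n := n) (d := d) (L := L)
    simp only [zero_mul]
    exact tilted_const _ 0
  have h := Theory2.SchwingerDyson.integral_dirLap_mul_weight hS B.mem 0 e
  simp only [zero_mul, Theory2.SchwingerDyson.weight, Real.exp_zero, mul_one] at h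
  rw [hμ]
  exact h.symm

/-- Hence the Casimir constant is the infinite-temperature mean action: `c = E_0[S_W]`. [ours] -/
theorem plaqConst_eq (hn : 2 ≤ n) (hL : 2 ≤ L) (B : SuBasis n) :
    plaqConst d L n = ∫ U, ambWilsonAction (coeConfig U)
        ∂(boltzmannMeasure fun U : GaugeConfig d L (Matrix.specialUnitaryGroup (Fin n) ℂ) =>
          (0 : ℝ) * ambWilsonAction (coeConfig U)) := by
  have h := sum_integral_dirLap_eq (d := d) hL B 0
  simp only [integral_dirLap_zero, Finset.sum_const_zero] at h
  have hC : (4 * casimirF n) ≠ 0 := by have := casimirF_pos hn; positivity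
  have h' : plaqConst d L n - ∫ U, ambWilsonAction (coeConfig U)
      ∂(boltzmannMeasure fun U : GaugeConfig d L (Matrix.specialUnitaryGroup (Fin n) ℂ) =>
        (0 : ℝ) * ambWilsonAction (coeConfig U)) = 0 := by
    rcases mul_eq_zero.1 h.symm with h0 | h0
    · exact absurd h0 hC
    · exact h0
  linarith

/-- **The total mean Laplacian is bounded below, uniformly in the volume per link.** On
`(ℤ/L)^{d+2}`, `L ≥ 2`, `0 ≤ β₀ ≤ β`:
`Σₑ E_β[ΔₑS_W] ≥ 4C_F · β₀ · L⌊L/2⌋^{d+1} e^{−8n(d+1)β₀} V_H(n)`. [ours] -/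
theorem sum_integral_dirLap_ge (hn : 2 ≤ n) (hL : 2 ≤ L) (B : SuBasis n) {β₀ β : ℝ}
    (hβ₀ : 0 ≤ β₀) (hβ : β₀ ≤ β) :
    4 * casimirF n * (β₀ * ((((L * (L / 2) ^ (d + 1) : ℕ) : ℝ) *
        Real.exp (-(8 * n * (d + 1) * β₀))) *
        variance (fun g : ↥(Matrix.specialUnitaryGroup (Fin n) ℂ) =>
          ((StrongCoupling.defRep n) g).trace.re)
          (haarProbability ↥(Matrix.specialUnitaryGroup (Fin n) ℂ)))) ≤
      ∑ e, ∫ U, dirLap B.T (ambWilsonAction : AmbConfig (d + 2) L n → ℝ) e (coeConfig U)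
        ∂(boltzmannMeasure fun U : GaugeConfig (d + 2) L (Matrix.specialUnitaryGroup (Fin n) ℂ) =>
          β * ambWilsonAction (coeConfig U)) := by
  rw [sum_integral_dirLap_eq hL B β, plaqConst_eq hn hL B]
  exact mul_le_mul_of_nonneg_left (meanAction_deficit hL hβ₀ hβ)
    (by have := casimirF_pos hn; positivity)

end MeanPlaquette

end Summit.Ventures.LatticeQCDFlow.Theory2.WilsonSpecificHeat

end
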